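import Summits.HubbardSuperconductivity.HubbardSuperconductivity.Theses.AposterioriCapRg
import Literature.MathematicalPhysics.QuantumLattice.XYOrderProofs
import Literature.MathematicalPhysics.QuantumLattice.FinDimSpectrumProofs

/-!
# Vocabulary of the spectral line for the crux `XYOrderOpennessLargeSpin` (route `AposterioriCapRg`)

Crux item stmt-HubbardSuperconductivity-13895, decl
`Summit.HubbardSuperconductivity.HubbardSuperconductivity.Theses.AposterioriCapRg.XYOrderOpennessLargeSpin`;
line `feynman-sector-gap` (merged with `landau-floor-feynman-bijl` by the triage panels: one spectral line).
This file only NAMES the objects the line's stubs are stated over; every definition is a literal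
re-packaging of a sub-term of the crux or a standard finite-volume object of Kennedy–Lieb–Shastry's
bookkeeping (KLS, PRL 61 (1988) 2582, eqs. (2)–(6)) for the PERTURBED torus Hamiltonian:

* `Admissible n r L w` — the crux's admissibility clause for a rule family `w` on the torus of side `L`
  (range `r`, Hermitian with spectrum in `[-1,1]`, `U(1)`-invariant, translation- and inversion-covariant),
  verbatim; `NormBoundedRuleSum`, `LocalRuleSum` — the two weakenings the clause-free stubs consume;
* `hpert L n W ε = xyTorus 2 L n + ε • W` (reducible) and the crux's double sum `orderSum`;
* the Fourier modes `spinMode L n q α = Σ_x e^{-i p·x} S^α_x` (`p·x = torusPhase L q x`), the in-plane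
  structure factor `modeWeight = Re ω(Ŝ⁰ᴴŜ⁰ + Ŝ¹ᴴŜ¹)` and first spectral moment ("oscillator strength")
  `modeOsc = Re ω(Ŝ⁰ᴴ[H,Ŝ⁰] + Ŝ¹ᴴ[H,Ŝ¹])` of the tracial ground state of a Hamiltonian `H`;
* `doubleComm A X = [Aᴴ,[X,A]]` — the double commutator bounding `modeOsc` piece by piece;
* `ModeFloor L n H q Δ` — the transfer target's local form: an orthogonal projection `Q` containing the
  ranges of `Ŝ⁰_q P₀`, `Ŝ¹_q P₀` (`P₀ = groundProj H`) on which `H ≥ E₀ + Δ` (the in-plane modes applied to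
  ground states see no spectrum below `E₀ + Δ`; implied by a momentum-sector gap `Δ` at momentum `q`);
* `xyOrderOpennessLargeSpin_iff` — faithfulness: the crux is literally the statement over these names.

Nothing is proved here except the `Iff.rfl` faithfulness check. Sources: KLS1988PRL eqs. (2)–(6);
Feynman, Phys. Rev. 94 (1954) 262 (single-mode states); Pitaevskii–Stringari, J. Low Temp. Phys. 85
(1991) 377 (`T = 0` sum-rule inequalities).
-/

noncomputable section

namespace Summit.HubbardSuperconductivity.HubbardSuperconductivity.Theorems.XYOrderOpennessLargeSpin

set_option linter.dupNamespace false -- summit = problem name (single-conjunct summit), D-0017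

open Matrix Complex Finset
open scoped ComplexOrder
open Literature.MathematicalPhysics.QuantumLattice Literature.Probability.LatticeModels
open Summit.HubbardSuperconductivity.HubbardSuperconductivity.Theses.AposterioriCapRg

/-- The crux's admissibility clause for a rule family `w` on the torus of side `L` (range `r`,
Hermitian with spectrum in `[-1,1]`, `U(1)`-invariant, translation- and site-inversion-covariant) —
verbatim the conjunction under `∀ x` in `XYOrderOpennessLargeSpin`. [folklore] -/
def Admissible (n r L : ℕ) [NeZero L]
    (w : TorusSite 2 L → Op (TorusSite 2 L) (n + 1)) : Prop :=
  ∀ x, IsSupportedOn (w x) (torusBall x r) ∧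
    (∃ hw : Matrix.IsHermitian (w x), ∀ i, |hw.eigenvalues i| ≤ 1) ∧
    Commute (w x) (totalSpin n 2) ∧
    (∀ v, reindexOp (Equiv.addRight v) (w x) = w (x + v)) ∧
    reindexOp (Equiv.neg (TorusSite 2 L)) (w x) = w (-x)

/-- `W` is a sum over sites of Hermitian rules with spectrum in `[-1,1]` (so `‖W‖ ≤ L²`): the part of
admissibility the energy/Parseval stubs use. [folklore] -/
def NormBoundedRuleSum (n L : ℕ) [NeZero L] (W : Op (TorusSite 2 L) (n + 1)) : Prop :=
  ∃ w : TorusSite 2 L → Op (TorusSite 2 L) (n + 1), W = ∑ x, w x ∧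
    ∀ x, ∃ hw : Matrix.IsHermitian (w x), ∀ i, |hw.eigenvalues i| ≤ 1

/-- `W` is a sum over sites of range-`r` Hermitian rules with spectrum in `[-1,1]`: the part of
admissibility the double-commutator stub uses. [folklore] -/
def LocalRuleSum (n r L : ℕ) [NeZero L] (W : Op (TorusSite 2 L) (n + 1)) : Prop :=
  ∃ w : TorusSite 2 L → Op (TorusSite 2 L) (n + 1), W = ∑ x, w x ∧
    ∀ x, IsSupportedOn (w x) (torusBall x r) ∧
      ∃ hw : Matrix.IsHermitian (w x), ∀ i, |hw.eigenvalues i| ≤ 1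

/-- The perturbed Hamiltonian `xyTorus 2 L n + ε W` of the crux (reducible abbreviation). [folklore] -/
abbrev hpert (L : ℕ) [NeZero L] (n : ℕ) (W : Op (TorusSite 2 L) (n + 1)) (ε : ℝ) :
    Op (TorusSite 2 L) (n + 1) :=
  xyTorus 2 L n + (ε : ℂ) • W

/-- The crux's double sum `Σ_{x,y} Re ω_H(S⁰_x S⁰_y + S¹_x S¹_y)` (in-plane order of the tracial
ground state of `H`). [cite: KLS1988PRL, Theorem] -/
def orderSum (L : ℕ) [NeZero L] (n : ℕ) (H : Op (TorusSite 2 L) (n + 1)) : ℝ :=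
  ∑ x : TorusSite 2 L, ∑ y : TorusSite 2 L,
    (H.groundStateFunctional (siteSpin n x 0 * siteSpin n y 0 + siteSpin n x 1 * siteSpin n y 1)).re

/-- The (unnormalised) Fourier mode `Ŝ^α_q = Σ_x e^{-i p·x} S^α_x`, `p·x = torusPhase L q x`.
[cite: KLS1988PRL, before eq. (2)] -/
def spinMode (L : ℕ) [NeZero L] (n : ℕ) (q : TorusSite 2 L) (α : Fin 3) :
    Op (TorusSite 2 L) (n + 1) :=
  ∑ x : TorusSite 2 L, Complex.exp (-(Complex.I * (torusPhase L q x : ℂ))) • siteSpin n x α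

/-- In-plane structure factor of the tracial ground state of `H` at momentum `q`:
`C_H(q) = Re ω_H(Ŝ⁰_qᴴ Ŝ⁰_q + Ŝ¹_qᴴ Ŝ¹_q)` (`C_H(0) = orderSum`, `Σ_q C_H(q) = L² Σ_x ω((S⁰_x)²+(S¹_x)²)`).
[cite: KLS1988PRL, eq. (2)] -/
def modeWeight (L : ℕ) [NeZero L] (n : ℕ) (H : Op (TorusSite 2 L) (n + 1)) (q : TorusSite 2 L) : ℝ :=
  (H.groundStateFunctional ((spinMode L n q 0)ᴴ * spinMode L n q 0 +
      (spinMode L n q 1)ᴴ * spinMode L n q 1)).re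

/-- First spectral moment ("oscillator strength") of the in-plane modes in the tracial ground state of
`H`: `f_H(q) = Re ω_H(Ŝ⁰_qᴴ [H, Ŝ⁰_q] + Ŝ¹_qᴴ [H, Ŝ¹_q]) = Σ_α ω(Ŝ^αᴴ (H - E₀) Ŝ^α) ≥ 0`.
[Pitaevskii–Stringari 1991, `m₁`; Feynman 1954] [folklore] -/
def modeOsc (L : ℕ) [NeZero L] (n : ℕ) (H : Op (TorusSite 2 L) (n + 1)) (q : TorusSite 2 L) : ℝ :=
  (H.groundStateFunctional ((spinMode L n q 0)ᴴ * (H * spinMode L n q 0 - spinMode L n q 0 * H) +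
      (spinMode L n q 1)ᴴ * (H * spinMode L n q 1 - spinMode L n q 1 * H))).re

/-- The double commutator `[Aᴴ, [X, A]] = Aᴴ(XA - AX) - (XA - AX)Aᴴ` (for the modes `A = Ŝ^α_q` and
`X` a Hamiltonian piece: KLS's `f`-sum / double-commutator object, J. Stat. Phys. 53 (1988) eq. (13)).
[cite: KLS1988JSP, eq. (13)] -/
def doubleComm {m : Type*} [Fintype m] (A X : Matrix m m ℂ) : Matrix m m ℂ :=
  Aᴴ * (X * A - A * X) - (X * A - A * X) * Aᴴ

/-- **Mode floor** (local form of a momentum-sector gap): there is an orthogonal projection `Q` whose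
range contains `Ŝ⁰_q P₀` and `Ŝ¹_q P₀` (`P₀ = groundProj H`, i.e. the in-plane modes applied to every
ground vector) and on which `H ≥ E₀ + Δ`. With `Q` the spectral projection of `H` on `[E₀ + Δ, ∞)`
this says: the spectral measures of `Ŝ^α_q · (ground vectors)` carry no weight below `E₀ + Δ`; with
`Q` a lattice-momentum projection it is implied by a sector gap `Δ` at momentum `q`.
[Feynman 1954; Pitaevskii–Stringari 1991] [folklore] -/
def ModeFloor (L : ℕ) [NeZero L] (n : ℕ) (H : Op (TorusSite 2 L) (n + 1)) (q : TorusSite 2 L)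
    (Δ : ℝ) : Prop :=
  ∃ Q : Op (TorusSite 2 L) (n + 1), Qᴴ = Q ∧ Q * Q = Q ∧
    Q * (spinMode L n q 0 * H.groundProj) = spinMode L n q 0 * H.groundProj ∧
    Q * (spinMode L n q 1 * H.groundProj) = spinMode L n q 1 * H.groundProj ∧
    (Q * (H - ((H.groundEnergy + Δ : ℝ) : ℂ) • (1 : Op (TorusSite 2 L) (n + 1))) * Q).PosSemidef

/-- **Record of the dropped route item `XYOrderOpennessLargeSpin`** = stmt-HubbardSuperconductivity-13895 (ledger
signature verbatim, under its original fully-qualified name; NOT a route item): the rank-4 crux was DROPPED from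
route `AposterioriCapRg` at rev 33 (2026-08-16T06:34Z, unused-crux repair; item closed `moot`), after which the
gate-written `Theses/AposterioriCapRg.lean` stopped declaring this constant, while this vocabulary file — append-only,
statement text fixed — still names it in the faithfulness lemma `xyOrderOpennessLargeSpin_iff` ("Unknown
identifier" in the full builds of 2026-08-16). Re-declared here with its original definiens solely so that the
line's vocabulary and its registered stubs keep elaborating; its dossier (advisory falsifier, tightness trio) lives
under `Cruxes/XYOrderOpennessLargeSpin/` and `Theorems/XYOrderOpennessLargeSpin/Negative/`. FALSE without each
covariance clause (the Negative trio); open as typed. -/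
def _root_.Summit.HubbardSuperconductivity.HubbardSuperconductivity.Theses.AposterioriCapRg.XYOrderOpennessLargeSpin :
    Prop :=
  ∃ n₀ : ℕ, 1 ≤ n₀ ∧ ∀ (n r : ℕ), n₀ ≤ n → ∃ ε₀ : ℝ, 0 < ε₀ ∧ ∀ (W : ∀ L : ℕ, Literature.MathematicalPhysics.QuantumLattice.Op (Literature.Probability.LatticeModels.TorusSite 2 L) (n + 1)) (ε : ℝ), |ε| ≤ ε₀ → (∀ (L : ℕ) [NeZero L], ∃ w : Literature.Probability.LatticeModels.TorusSite 2 L → Literature.MathematicalPhysics.QuantumLattice.Op (Literature.Probability.LatticeModels.TorusSite 2 L) (n + 1), W L = ∑ x, w x ∧ ∀ x, Literature.MathematicalPhysics.QuantumLattice.IsSupportedOn (w x) (Literature.MathematicalPhysics.QuantumLattice.torusBall x r) ∧ (∃ hw : Matrix.IsHermitian (w x), ∀ i, |hw.eigenvalues i| ≤ 1) ∧ Commute (w x) (Literature.MathematicalPhysics.QuantumLattice.totalSpin n 2) ∧ (∀ v, Literature.MathematicalPhysics.QuantumLattice.reindexOp (Equiv.addRight v) (w x) = w (x + v)) ∧ Literature.MathematicalPhysics.QuantumLattice.reindexOp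 (Equiv.neg (Literature.Probability.LatticeModels.TorusSite 2 L)) (w x) = w (-x)) → ∃ k₀ : ℕ, ∀ k : ℕ, k₀ ≤ k → ∀ [NeZero (2 * k)], ((n : ℝ) / 2) ^ 2 / 4 ≤ (∑ x : Literature.Probability.LatticeModels.TorusSite 2 (2 * k), ∑ y : Literature.Probability.LatticeModels.TorusSite 2 (2 * k), ((Literature.MathematicalPhysics.QuantumLattice.xyTorus 2 (2 * k) n + (ε : ℂ) • W (2 * k)).groundStateFunctional (Literature.MathematicalPhysics.QuantumLattice.siteSpin n x 0 * Literature.MathematicalPhysics.QuantumLattice.siteSpin n y 0 + Literature.MathematicalPhysics.QuantumLattice.siteSpin n x 1 * Literature.MathematicalPhysics.QuantumLattice.siteSpin n y 1)).re) / ((2 * k : ℕ) : ℝ) ^ 4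

/-- Faithfulness: the crux is literally
`∃ n₀ ≥ 1 ∀ n ≥ n₀ ∀ r ∃ ε₀ > 0 ∀ W ε, |ε| ≤ ε₀ → (∀ L, ∃ w, W L = Σ w ∧ Admissible n r L w) →
 eventually in k, (n/2)²/4 ≤ orderSum (2k) n (hpert (2k) n (W (2k)) ε) / (2k)⁴`. [folklore] -/
theorem xyOrderOpennessLargeSpin_iff : XYOrderOpennessLargeSpin ↔
    ∃ n₀ : ℕ, 1 ≤ n₀ ∧ ∀ (n r : ℕ), n₀ ≤ n → ∃ ε₀ : ℝ, 0 < ε₀ ∧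
      ∀ (W : ∀ L : ℕ, Op (TorusSite 2 L) (n + 1)) (ε : ℝ), |ε| ≤ ε₀ →
        (∀ (L : ℕ) [NeZero L], ∃ w : TorusSite 2 L → Op (TorusSite 2 L) (n + 1),
            W L = ∑ x, w x ∧ Admissible n r L w) →
        ∃ k₀ : ℕ, ∀ k : ℕ, k₀ ≤ k → ∀ [NeZero (2 * k)],
          ((n : ℝ) / 2) ^ 2 / 4 ≤ orderSum (2 * k) n (hpert (2 * k) n (W (2 * k)) ε) / ((2 * k : ℕ) : ℝ) ^ 4 :=
  Iff.rfl

end Summit.HubbardSuperconductivity.HubbardSuperconductivity.Theorems.XYOrderOpennessLargeSpin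

end
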